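import Summits.QuantumFields.YangMills.Theorems.SlowBitWindowPersistenceChain
import Summits.QuantumFields.YangMills.Theorems.SwapTwistDeficitSmallBallFloors
import Summits.QuantumFields.YangMills.Theorems.SlowBitWindowStepPersistenceMinorant
import HarnessLib

/-!
# The LARGE-FIELD CUT along the closed `2L`-chain: slices with magnetic energy `≥ s` cost `e^{−βs/2}` against the supremum, hence carry
# zero-flux thermal weight `≤ e^{−βs/2}·β^{2LN}·Z_phys(2L)`

Support module for the crux `ToronSmallBall.OffCoreStripWindow` (item stmt-QuantumFields-23899, LINE g12-A of seat ym-idea-4; also useful for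
`ToronCoreRarity` stmt-QuantumFields-23898).  The planned mechanism for the off-core strip (quasi-invariance of the `2L`-slice zero-flux path measure under
the gauge-covariant global toron shift) controls the action change through plaquette deviations; it therefore needs a cut «every plaquette of every slice is
within `r` of `1`» whose complement is thermally negligible UNIFORMLY on the window.  This file proves that cut with the crude tools of the door files:

* §1 pointwise: each bond kernel carries the magnetic factor of both its slices, `K_β(U,V) ≤ (e^{2β})^{|E|} e^{−(β/2)S(U)}` and `≤ (e^{2β})^{|E|} e^{−(β/2)S(V)}`,
  and so does the physically averaged seam (`S` is gauge and twist invariant); hence `chain·𝟙[s ≤ S(U_t)] ≤ (e^{2β|E|})^{2L}·e^{−βs/2}` for EVERY slice `t`;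
* §2 integrated: `insTrace L β 𝟙{s ≤ S} 0 ≤ (e^{2β|E|})^{2L} e^{−βs/2}` (slice `0`) and `∫ chain·𝟙[∃ t, s ≤ S(U_t)] ≤ 2L·(e^{2β|E|})^{2L} e^{−βs/2}` (all slices);
* §3 normalised by the explicit floor `Z_phys(2L) ≥ (e^{2β|E|}β^{−N})^{2L}` (`N = 8|P| + 97|E|`, `β ≥ max(9, 4/w₀)`): slice-`0` weight `≤ e^{−βs/2} β^{2LN} Z`; and the
  plaquette form `{∃ p, ‖U_p − 1‖_F ≥ r} ⊆ {r²/2 ≤ S}` — so plaquette deviations `≥ √(2s)` with `βs/2 = (2LN + a)·log β`, i.e. `r ≍ L²√(log β/β)` on `L ≤ β^a`,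
  are `β^{−a}`-negligible.

HONEST FRAMING: crude fixed-lattice bookkeeping (sup bounds against a polynomial floor); no semiclassics/RG; nothing about infinite volume, the continuum or the
Clay gap.  No `sorry`, no new axiom, no new definition.  References: [cite: SeilerLNP1982, §3]; [cite: MontvayMunster1994, (3.145)]; [cite: Luscher1983, §2].
-/

set_option autoImplicit false

noncomputable section

open MeasureTheory Filter Topology Real Function
open scoped Matrix ComplexConjugate BigOperators
open Literature.MathematicalPhysics.QuantumLattice
open Literature.MathematicalPhysics.QuantumFieldTheory hiding SU2
open Summit.QuantumFields.YangMills.Theorems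

namespace Summit.QuantumFields.YangMills.Theorems.FemtoTransferGap.TT

open Summit.QuantumFields.YangMills.Theorems.FemtoTransferGap

variable {L : ℕ} [NeZero L]

/-! ## §1 Pointwise: every bond carries the magnetic Boltzmann factor of both its slices -/

/-- `K_β(U,V) ≤ (e^{2β})^{|E|} · e^{−(β/2)S(U)}` (`β ≥ 0`). [cite: SeilerLNP1982, §3] -/
theorem transferKernel_le_exp_mul_expAction_left {β : ℝ} (hβ : 0 ≤ β) (U V : GaugeConfig 3 L SU2) :
    transferKernel su2Rep β U V ≤ Real.exp (2 * β) ^ Fintype.card (Edge 3 L) * Real.exp (-(β / 2) * wilsonAction su2Rep U) := by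
  rw [transferKernel_eq_latE_mul]
  have hS := wilsonAction_su2_nonneg_lat V
  have h1 : Real.exp (-(β / 2) * (wilsonAction su2Rep U + wilsonAction su2Rep V)) ≤ Real.exp (-(β / 2) * wilsonAction su2Rep U) :=
    Real.exp_le_exp.2 (by nlinarith)
  exact mul_le_mul (latE_le hβ U V) h1 (Real.exp_pos _).le (by positivity)

/-- `K_β(U,V) ≤ (e^{2β})^{|E|} · e^{−(β/2)S(V)}` (`β ≥ 0`). [cite: SeilerLNP1982, §3] -/
theorem transferKernel_le_exp_mul_expAction_right {β : ℝ} (hβ : 0 ≤ β) (U V : GaugeConfig 3 L SU2) :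
    transferKernel su2Rep β U V ≤ Real.exp (2 * β) ^ Fintype.card (Edge 3 L) * Real.exp (-(β / 2) * wilsonAction su2Rep V) := by
  rw [transferKernel_eq_latE_mul]
  have hS := wilsonAction_su2_nonneg_lat U
  have h1 : Real.exp (-(β / 2) * (wilsonAction su2Rep U + wilsonAction su2Rep V)) ≤ Real.exp (-(β / 2) * wilsonAction su2Rep V) :=
    Real.exp_le_exp.2 (by nlinarith)
  exact mul_le_mul (latE_le hβ U V) h1 (Real.exp_pos _).le (by positivity)

/-- The physically averaged seam carries the magnetic factor of its right slice: `K_β^P(U,V) ≤ (e^{2β})^{|E|} e^{−(β/2)S(V)}` (the Wilson action is gauge and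
centre-twist invariant). [cite: Luscher1983, §2] -/
theorem physAvg_transferKernel_le_exp_mul_expAction {β : ℝ} (hβ : 0 ≤ β) (U V : GaugeConfig 3 L SU2) :
    physAvg (transferKernel su2Rep β U) V ≤ Real.exp (2 * β) ^ Fintype.card (Edge 3 L) * Real.exp (-(β / 2) * wilsonAction su2Rep V) := by
  set M : ℝ := Real.exp (2 * β) ^ Fintype.card (Edge 3 L) with hM
  have hw : IsPhys (fun W : GaugeConfig 3 L SU2 => Real.exp (-(β / 2) * wilsonAction su2Rep W)) := isPhys_expAction (-(β / 2))
  haveI : IsProbabilityMeasure (gaugeMeasure L) := isProbabilityMeasure_gaugeMeasure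
  have hterm : ∀ (z : Fin 3 → Bool), ∫ g, transferKernel su2Rep β U (gaugeTransform g (twist3 z V)) ∂gaugeMeasure L ≤
      M * Real.exp (-(β / 2) * wilsonAction su2Rep V) := by
    intro z
    have h1 : ∫ g, transferKernel su2Rep β U (gaugeTransform g (twist3 z V)) ∂gaugeMeasure L ≤
        ∫ _g, M * Real.exp (-(β / 2) * wilsonAction su2Rep V) ∂gaugeMeasure L := by
      refine integral_mono_of_nonneg (ae_of_all _ fun g => (transferKernel_pos _ _ _ _).le) (integrable_const _) (ae_of_all _ fun g => ?_)
      have h := transferKernel_le_exp_mul_expAction_right hβ U (gaugeTransform g (twist3 z V))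
      have hinv : Real.exp (-(β / 2) * wilsonAction su2Rep (gaugeTransform g (twist3 z V))) = Real.exp (-(β / 2) * wilsonAction su2Rep V) :=
        act_eq_of_isPhys hw g z V
      rw [hinv] at h
      exact h
    rwa [integral_const, smul_eq_mul, probReal_univ, one_mul] at h1
  unfold physAvg
  calc (1 / 8 : ℝ) * ∑ z : Fin 3 → Bool, ∫ g, transferKernel su2Rep β U (gaugeTransform g (twist3 z V)) ∂gaugeMeasure L
      ≤ (1 / 8 : ℝ) * ∑ _z : Fin 3 → Bool, M * Real.exp (-(β / 2) * wilsonAction su2Rep V) :=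
        mul_le_mul_of_nonneg_left (Finset.sum_le_sum fun z _ => hterm z) (by norm_num)
    _ = M * Real.exp (-(β / 2) * wilsonAction su2Rep V) := by
        rw [Finset.sum_const, Finset.card_univ, card_twists, nsmul_eq_mul]; ring

/-- ★ **Pointwise large-field cost, slice `0`**: `chain·𝟙[s ≤ S(U₀)] ≤ (e^{2β|E|})^{2L−1}·(e^{2β|E|}) · e^{−βs/2}` (`β ≥ 0`). [cite: SeilerLNP1982, §3] -/
theorem chain_mul_indicator_largeAction_zero_le {β : ℝ} (hβ : 0 ≤ β) (s : ℝ) (Us : Fin (2 * L - 1 + 1) → GaugeConfig 3 L SU2) :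
    (∏ i : Fin (2 * L - 1), transferKernel su2Rep β (Us i.castSucc) (Us i.succ)) *
          physAvg (transferKernel su2Rep β (Us (Fin.last (2 * L - 1)))) (Us 0) *
        Set.indicator {U : GaugeConfig 3 L SU2 | s ≤ wilsonAction su2Rep U} (fun _ => (1 : ℝ)) (Us 0) ≤
      (Real.exp (2 * β) ^ Fintype.card (Edge 3 L)) ^ (2 * L - 1) * Real.exp (2 * β) ^ Fintype.card (Edge 3 L) * Real.exp (-(β / 2 * s)) := by
  set M : ℝ := Real.exp (2 * β) ^ Fintype.card (Edge 3 L) with hM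
  have hKM : ∀ U V : GaugeConfig 3 L SU2, transferKernel su2Rep β U V ≤ M := fun U V =>
    (le_abs_self _).trans (abs_transferKernel_le_lat hβ (U, V))
  have hprod : (∏ i : Fin (2 * L - 1), transferKernel su2Rep β (Us i.castSucc) (Us i.succ)) ≤ M ^ (2 * L - 1) := by
    calc (∏ i : Fin (2 * L - 1), transferKernel su2Rep β (Us i.castSucc) (Us i.succ)) ≤ ∏ _i : Fin (2 * L - 1), M :=
          Finset.prod_le_prod (fun i _ => (transferKernel_pos _ _ _ _).le) fun i _ => hKM _ _
      _ = M ^ (2 * L - 1) := by rw [Finset.prod_const, Finset.card_univ, Fintype.card_fin]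
  have hprod0 : 0 ≤ ∏ i : Fin (2 * L - 1), transferKernel su2Rep β (Us i.castSucc) (Us i.succ) :=
    Finset.prod_nonneg fun i _ => (transferKernel_pos _ _ _ _).le
  have hP := physAvg_transferKernel_le_exp_mul_expAction hβ (Us (Fin.last (2 * L - 1))) (Us 0)
  have hP0 : 0 ≤ physAvg (transferKernel su2Rep β (Us (Fin.last (2 * L - 1)))) (Us 0) :=
    physAvg_nonneg (fun V => (transferKernel_pos _ _ _ V).le) _
  by_cases hs : Us 0 ∈ {U : GaugeConfig 3 L SU2 | s ≤ wilsonAction su2Rep U}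
  · rw [Set.indicator_of_mem hs, mul_one]
    have hs' : s ≤ wilsonAction su2Rep (Us 0) := hs
    have hexp : Real.exp (-(β / 2) * wilsonAction su2Rep (Us 0)) ≤ Real.exp (-(β / 2 * s)) := Real.exp_le_exp.2 (by nlinarith)
    calc (∏ i : Fin (2 * L - 1), transferKernel su2Rep β (Us i.castSucc) (Us i.succ)) *
          physAvg (transferKernel su2Rep β (Us (Fin.last (2 * L - 1)))) (Us 0)
        ≤ M ^ (2 * L - 1) * (M * Real.exp (-(β / 2) * wilsonAction su2Rep (Us 0))) := mul_le_mul hprod hP hP0 (by positivity)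
      _ ≤ M ^ (2 * L - 1) * (M * Real.exp (-(β / 2 * s))) :=
          mul_le_mul_of_nonneg_left (mul_le_mul_of_nonneg_left hexp (by positivity)) (by positivity)
      _ = M ^ (2 * L - 1) * M * Real.exp (-(β / 2 * s)) := by ring
  · rw [Set.indicator_of_notMem hs, mul_zero]; positivity

/-- ★ **Pointwise large-field cost, slice `i+1`**: the bond `(U_i, U_{i+1})` carries `e^{−(β/2)S(U_{i+1})}`. [cite: SeilerLNP1982, §3] -/
theorem chain_mul_indicator_largeAction_succ_le {β : ℝ} (hβ : 0 ≤ β) (s : ℝ) (i : Fin (2 * L - 1))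
    (Us : Fin (2 * L - 1 + 1) → GaugeConfig 3 L SU2) :
    (∏ j : Fin (2 * L - 1), transferKernel su2Rep β (Us j.castSucc) (Us j.succ)) *
          physAvg (transferKernel su2Rep β (Us (Fin.last (2 * L - 1)))) (Us 0) *
        Set.indicator {U : GaugeConfig 3 L SU2 | s ≤ wilsonAction su2Rep U} (fun _ => (1 : ℝ)) (Us i.succ) ≤
      (Real.exp (2 * β) ^ Fintype.card (Edge 3 L)) ^ (2 * L - 1) * Real.exp (2 * β) ^ Fintype.card (Edge 3 L) * Real.exp (-(β / 2 * s)) := by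
  set M : ℝ := Real.exp (2 * β) ^ Fintype.card (Edge 3 L) with hM
  have hKM : ∀ U V : GaugeConfig 3 L SU2, transferKernel su2Rep β U V ≤ M := fun U V =>
    (le_abs_self _).trans (abs_transferKernel_le_lat hβ (U, V))
  have hPM : physAvg (transferKernel su2Rep β (Us (Fin.last (2 * L - 1)))) (Us 0) ≤ M :=
    (le_abs_self _).trans (abs_physAvg_le (fun W => abs_transferKernel_le_lat hβ (Us (Fin.last (2 * L - 1)), W)) _)
  have hP0 : 0 ≤ physAvg (transferKernel su2Rep β (Us (Fin.last (2 * L - 1)))) (Us 0) :=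
    physAvg_nonneg (fun V => (transferKernel_pos _ _ _ V).le) _
  have hsplit : (∏ j : Fin (2 * L - 1), transferKernel su2Rep β (Us j.castSucc) (Us j.succ)) =
      transferKernel su2Rep β (Us i.castSucc) (Us i.succ) *
        ∏ j ∈ Finset.univ.erase i, transferKernel su2Rep β (Us j.castSucc) (Us j.succ) := by
    rw [← Finset.mul_prod_erase Finset.univ _ (Finset.mem_univ i)]
  have hrest : ∏ j ∈ Finset.univ.erase i, transferKernel su2Rep β (Us j.castSucc) (Us j.succ) ≤ M ^ (2 * L - 2) := by
    calc ∏ j ∈ Finset.univ.erase i, transferKernel su2Rep β (Us j.castSucc) (Us j.succ) ≤ ∏ _j ∈ Finset.univ.erase i, M :=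
          Finset.prod_le_prod (fun j _ => (transferKernel_pos _ _ _ _).le) fun j _ => hKM _ _
      _ = M ^ (2 * L - 2) := by
          rw [Finset.prod_const, Finset.card_erase_of_mem (Finset.mem_univ _), Finset.card_univ, Fintype.card_fin,
            show 2 * L - 1 - 1 = 2 * L - 2 by omega]
  have hrest0 : 0 ≤ ∏ j ∈ Finset.univ.erase i, transferKernel su2Rep β (Us j.castSucc) (Us j.succ) :=
    Finset.prod_nonneg fun j _ => (transferKernel_pos _ _ _ _).le
  have hKi := transferKernel_le_exp_mul_expAction_right hβ (Us i.castSucc) (Us i.succ)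
  by_cases hs : Us i.succ ∈ {U : GaugeConfig 3 L SU2 | s ≤ wilsonAction su2Rep U}
  · rw [Set.indicator_of_mem hs, mul_one]
    have hs' : s ≤ wilsonAction su2Rep (Us i.succ) := hs
    have hexp : Real.exp (-(β / 2) * wilsonAction su2Rep (Us i.succ)) ≤ Real.exp (-(β / 2 * s)) := Real.exp_le_exp.2 (by nlinarith)
    have hL1 : 1 ≤ 2 * L - 1 := by have := NeZero.one_le (n := L); omega
    calc (∏ j : Fin (2 * L - 1), transferKernel su2Rep β (Us j.castSucc) (Us j.succ)) *
          physAvg (transferKernel su2Rep β (Us (Fin.last (2 * L - 1)))) (Us 0)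
        = transferKernel su2Rep β (Us i.castSucc) (Us i.succ) *
            (∏ j ∈ Finset.univ.erase i, transferKernel su2Rep β (Us j.castSucc) (Us j.succ)) *
            physAvg (transferKernel su2Rep β (Us (Fin.last (2 * L - 1)))) (Us 0) := by rw [hsplit]
      _ ≤ (M * Real.exp (-(β / 2) * wilsonAction su2Rep (Us i.succ))) * M ^ (2 * L - 2) * M :=
          mul_le_mul (mul_le_mul hKi hrest hrest0 (by positivity)) hPM hP0 (by positivity)
      _ ≤ (M * Real.exp (-(β / 2 * s))) * M ^ (2 * L - 2) * M := by
          refine mul_le_mul_of_nonneg_right (mul_le_mul_of_nonneg_right (mul_le_mul_of_nonneg_left hexp (by positivity)) (by positivity)) (by positivity)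
      _ = M ^ (2 * L - 1) * M * Real.exp (-(β / 2 * s)) := by
          have e : M ^ (2 * L - 1) = M * M ^ (2 * L - 2) := by
            rw [← pow_succ']; congr 1; omega
          rw [e]; ring
  · rw [Set.indicator_of_notMem hs, mul_zero]
    have := Finset.prod_nonneg (s := Finset.univ) fun (j : Fin (2 * L - 1)) _ => (transferKernel_pos su2Rep β (Us j.castSucc) (Us j.succ)).le
    positivity

/-! ## §2 Integrated: the thermal weight of a large-action slice -/

/-- ★ **Slice-`0` large-field cut**: `insTrace L β 𝟙{s ≤ S} 0 ≤ (e^{2β|E|})^{2L−1}(e^{2β|E|})·e^{−βs/2}` (`β ≥ 0`). [cite: SeilerLNP1982, §3] -/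
theorem insTrace_indicator_largeAction_le {β : ℝ} (hβ : 0 ≤ β) (s : ℝ) :
    insTrace L β (Set.indicator {U : GaugeConfig 3 L SU2 | s ≤ wilsonAction su2Rep U} fun _ => (1 : ℝ)) 0 ≤
      (Real.exp (2 * β) ^ Fintype.card (Edge 3 L)) ^ (2 * L - 1) * Real.exp (2 * β) ^ Fintype.card (Edge 3 L) * Real.exp (-(β / 2 * s)) := by
  rw [insTrace_indicator_zero]
  haveI : IsProbabilityMeasure (Measure.pi fun _ : Fin (2 * L - 1 + 1) => configMeasure SU2 L) := by infer_instance
  have h := integral_mono_of_nonneg (μ := Measure.pi fun _ : Fin (2 * L - 1 + 1) => configMeasure SU2 L)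
    (ae_of_all _ fun Us => mul_nonneg (chain_nonneg β Us) (Set.indicator_nonneg (fun _ _ => zero_le_one) _))
    (integrable_const _) (ae_of_all _ fun Us => chain_mul_indicator_largeAction_zero_le (L := L) hβ s Us)
  rwa [integral_const, smul_eq_mul, probReal_univ, one_mul] at h

/-- ★ **All-slices large-field cut**: `∫ chain·𝟙[∃ t, s ≤ S(U_t)] ≤ 2L·(e^{2β|E|})^{2L−1}(e^{2β|E|})·e^{−βs/2}` (`β ≥ 0`; union over the `2L` slices).
[cite: SeilerLNP1982, §3] -/
theorem integral_chain_indicator_largeAction_le {β : ℝ} (hβ : 0 ≤ β) (s : ℝ) :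
    ∫ Us : Fin (2 * L - 1 + 1) → GaugeConfig 3 L SU2,
        (∏ i : Fin (2 * L - 1), transferKernel su2Rep β (Us i.castSucc) (Us i.succ)) *
          physAvg (transferKernel su2Rep β (Us (Fin.last (2 * L - 1)))) (Us 0) *
          Set.indicator {Vs : Fin (2 * L - 1 + 1) → GaugeConfig 3 L SU2 | ∃ t, s ≤ wilsonAction su2Rep (Vs t)} (fun _ => (1 : ℝ)) Us
        ∂(Measure.pi fun _ : Fin (2 * L - 1 + 1) => configMeasure SU2 L) ≤
      (2 * L : ℕ) * ((Real.exp (2 * β) ^ Fintype.card (Edge 3 L)) ^ (2 * L - 1) * Real.exp (2 * β) ^ Fintype.card (Edge 3 L) * Real.exp (-(β / 2 * s))) := by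
  set B : ℝ := (Real.exp (2 * β) ^ Fintype.card (Edge 3 L)) ^ (2 * L - 1) * Real.exp (2 * β) ^ Fintype.card (Edge 3 L) * Real.exp (-(β / 2 * s)) with hB
  set A : Set (GaugeConfig 3 L SU2) := {U | s ≤ wilsonAction su2Rep U} with hA
  haveI : IsProbabilityMeasure (Measure.pi fun _ : Fin (2 * L - 1 + 1) => configMeasure SU2 L) := by infer_instance
  -- pointwise: the multi-slice indicator is dominated by the sum of the slice indicators, each costing `B`
  have hpt : ∀ Us : Fin (2 * L - 1 + 1) → GaugeConfig 3 L SU2,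
      (∏ i : Fin (2 * L - 1), transferKernel su2Rep β (Us i.castSucc) (Us i.succ)) *
          physAvg (transferKernel su2Rep β (Us (Fin.last (2 * L - 1)))) (Us 0) *
          Set.indicator {Vs : Fin (2 * L - 1 + 1) → GaugeConfig 3 L SU2 | ∃ t, s ≤ wilsonAction su2Rep (Vs t)} (fun _ => (1 : ℝ)) Us ≤
        (2 * L : ℕ) * B := by
    intro Us
    have h0 := chain_nonneg β Us
    by_cases hUs : Us ∈ {Vs : Fin (2 * L - 1 + 1) → GaugeConfig 3 L SU2 | ∃ t, s ≤ wilsonAction su2Rep (Vs t)}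
    · rw [Set.indicator_of_mem hUs, mul_one]
      obtain ⟨t, ht⟩ := hUs
      have hone : (1 : ℝ) ≤ (2 * L : ℕ) := by have := NeZero.one_le (n := L); exact_mod_cast (by omega : 1 ≤ 2 * L)
      have hB0 : 0 ≤ B := by positivity
      -- slice `t` is slice `0` or a successor
      rcases Fin.eq_zero_or_eq_succ t with h0t | ⟨i, hi⟩
      · have h := chain_mul_indicator_largeAction_zero_le (L := L) hβ s Us
        rw [Set.indicator_of_mem (show Us 0 ∈ A by rw [hA]; rw [h0t] at ht; exact ht), mul_one] at h
        calc _ ≤ B := h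
          _ = 1 * B := (one_mul B).symm
          _ ≤ (2 * L : ℕ) * B := mul_le_mul_of_nonneg_right hone hB0
      · have h := chain_mul_indicator_largeAction_succ_le (L := L) hβ s i Us
        rw [Set.indicator_of_mem (show Us i.succ ∈ A by rw [hA]; rw [hi] at ht; exact ht), mul_one] at h
        calc _ ≤ B := h
          _ = 1 * B := (one_mul B).symm
          _ ≤ (2 * L : ℕ) * B := mul_le_mul_of_nonneg_right hone hB0
    · rw [Set.indicator_of_notMem hUs, mul_zero]; positivity
  have h := integral_mono_of_nonneg (μ := Measure.pi fun _ : Fin (2 * L - 1 + 1) => configMeasure SU2 L)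
    (ae_of_all _ fun Us => mul_nonneg (chain_nonneg β Us) (Set.indicator_nonneg (fun _ _ => zero_le_one) _))
    (integrable_const _) (ae_of_all _ hpt)
  rwa [integral_const, smul_eq_mul, probReal_univ, one_mul] at h

/-! ## §3 Normalised by the floor, and the plaquette form -/

/-- A large plaquette deviation forces a large action: `r ≤ ‖U_p − 1‖_F ⇒ r²/2 ≤ S(U)` (`r ≥ 0`). [folklore] -/
theorem sq_half_le_wilsonAction_of_plaquette {U : GaugeConfig 3 L SU2} (x : Site 3 L) (i j : Fin 3) (hij : i < j) {r : ℝ} (hr : 0 ≤ r)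
    (h : r ≤ frobNorm (((plaquetteHolonomy U x i j : SU2) : Matrix (Fin 2) (Fin 2) ℂ) - 1)) :
    r ^ 2 / 2 ≤ wilsonAction su2Rep U := by
  have hterm : r ^ 2 / 2 ≤ 2 - ((su2Rep (plaquetteHolonomy U x i j)).trace).re := by
    rw [fundamentalRep_apply, two_sub_re_trace_eq]
    have := mul_le_mul h h hr (frobNorm_nonneg _)
    nlinarith
  have hsum : (2 - ((su2Rep (plaquetteHolonomy U x i j)).trace).re) ≤ wilsonAction su2Rep U := by
    have h1 : wilsonAction su2Rep U = ∑ p : Plaquette 3 L, (2 - ((su2Rep (plaquetteHolonomy U p.1 p.2.1.1 p.2.1.2)).trace).re) := by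
      unfold wilsonAction; simp
    rw [h1]
    have hp := Finset.single_le_sum (f := fun p : Plaquette 3 L => (2 - ((su2Rep (plaquetteHolonomy U p.1 p.2.1.1 p.2.1.2)).trace).re))
      (fun p _ => by
        have := re_trace_le_two (plaquetteHolonomy U p.1 p.2.1.1 p.2.1.2)
        simp only [fundamentalRep_apply]; linarith)
      (Finset.mem_univ ((x, ⟨(i, j), hij⟩) : Plaquette 3 L))
    exact hp
  exact hterm.trans hsum

/-- ★ **Normalised slice-`0` large-field cut**: for `β ≥ max(9, 4/w₀)`, `L ≥ 1`:
`insTrace L β 𝟙{s ≤ S} 0 ≤ e^{−βs/2} · (β^{N})^{2L} · Z_phys(2L)`, `N = 8|P| + 97|E|` — so `βs/2 ≥ (2LN + a) log β` makes slices with action `≥ s`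
(e.g. one plaquette with `‖U_p − 1‖_F ≥ √(2s) ≍ L²√(log β/β)` on `L ≤ β^a`) `β^{−a}`-negligible. [cite: Luscher1983, §2] -/
theorem insTrace_indicator_largeAction_le_floor (hL : 1 ≤ L) {β : ℝ} (hβ9 : 9 ≤ β)
    (hβw : 4 / (Real.exp (-(1 / 2 : ℝ)) * (8 / (3 * π ^ 3))) ≤ β) (s : ℝ) :
    insTrace L β (Set.indicator {U : GaugeConfig 3 L SU2 | s ≤ wilsonAction su2Rep U} fun _ => (1 : ℝ)) 0 ≤
      Real.exp (-(β / 2 * s)) * (β ^ (8 * Fintype.card (Plaquette 3 L) + 97 * Fintype.card (Edge 3 L))) ^ (2 * L) * physTrace L β (2 * L) := by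
  have hβ1 : 1 ≤ β := by linarith
  have hβ0 : 0 < β := by linarith
  set M : ℝ := Real.exp (2 * β) ^ Fintype.card (Edge 3 L) with hM
  set N : ℕ := 8 * Fintype.card (Plaquette 3 L) + 97 * Fintype.card (Edge 3 L) with hN
  have hcut := insTrace_indicator_largeAction_le (L := L) hβ0.le s
  have hlam : M * (β ^ N)⁻¹ ≤ levelValue su2Rep L β 0 := levelValue_zero_ge_rpow hβ9 hβw
  have hfloor : (M * (β ^ N)⁻¹) ^ (2 * L) ≤ physTrace L β (2 * L) :=
    (pow_le_pow_left₀ (by positivity) hlam _).trans (pow_levelValue_zero_le_physTrace hL hβ1)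
  have hMpow : M ^ (2 * L - 1) * M = M ^ (2 * L) := by
    rw [← pow_succ]; congr 1; omega
  rw [hMpow] at hcut
  have hkey : M ^ (2 * L) ≤ (β ^ N) ^ (2 * L) * physTrace L β (2 * L) := by
    have h := mul_le_mul_of_nonneg_left hfloor (by positivity : (0 : ℝ) ≤ (β ^ N) ^ (2 * L))
    have e : (β ^ N) ^ (2 * L) * (M * (β ^ N)⁻¹) ^ (2 * L) = M ^ (2 * L) := by
      rw [mul_pow, ← mul_assoc, mul_comm ((β ^ N) ^ (2 * L)), mul_assoc, ← mul_pow,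
        mul_inv_cancel₀ (pow_ne_zero _ hβ0.ne'), one_pow, mul_one]
    rw [e] at h; exact h
  calc insTrace L β (Set.indicator {U : GaugeConfig 3 L SU2 | s ≤ wilsonAction su2Rep U} fun _ => (1 : ℝ)) 0
      ≤ M ^ (2 * L) * Real.exp (-(β / 2 * s)) := hcut
    _ ≤ (β ^ N) ^ (2 * L) * physTrace L β (2 * L) * Real.exp (-(β / 2 * s)) := mul_le_mul_of_nonneg_right hkey (Real.exp_pos _).le
    _ = Real.exp (-(β / 2 * s)) * (β ^ N) ^ (2 * L) * physTrace L β (2 * L) := by ring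

end Summit.QuantumFields.YangMills.Theorems.FemtoTransferGap.TT

end
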